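import Summits.Ventures.PercRepro.ProfilePointedDirectSum
import Summits.Ventures.PercRepro.ProfilePointedColoopExtension
import Summits.Ventures.PercRepro.ProfilePointedLimit
import Summits.Ventures.PercRepro.ProfilePointedSeqConvProof

/-!
# PercRepro — THE BRIDGE: (Ĉ) AT EVERY LEVEL OF `(M₁, p)` GIVES (Ĉ) AT EVERY LEVEL OF `(M₁ ⊕ M₂, p)`, MODULO
THE SEQUENCE-LEVEL THEOREM (p10, gen 23; `proofs/P10-COLOOPEXT-g22.md` §7.1, §7.6, §7.9)

The matroid side of the direct-sum theorem is in `ProfilePointedDirectSum.lean` (the profile and the extension counts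
of `S = M₁ ⊕ M₂` are the convolutions `a ∗ P`, `a ∗ c` of the profiles `P = P(M₁)`, `a = P(M₂)` and the extension
counts `c = c^p(M₁)`); the arithmetic side is the `Prop` `SeqPointedConv` of `ProfilePointedSeqConv.lean`.  THIS FILE
joins them: the three sequences are packaged as zero-extended `ℤ → ℚ` sequences (`profZ`, `extZ`), each hypothesis of
`SeqPointedConv` is discharged from the landed facts — symmetry (`card_biIndepSets_symm`, `extCount_symm`), the
vanishing outside the ranges (`card_biIndepSets_eq_zero_of_lt`, `extCount_top`), Theorem A for `M₁`, `M₂` and for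
`c = P(M₁ / p)` (`biIndepDensity_mono_of_fact`, `extCount_eq_card_biIndepSets_contract`; a loop `p` has `c ≡ 0`),
`c 0 = P 0` (`extCount_zero`), the (Ĉ)-instances of `(M₁, p)` — and the two convolutions are identified with the
`ℤ`-indexed sums of the `Prop` (`conv_cast`).  The bridge `pointedRowAt_disjointSum_of_seq` takes `SeqPointedConv` as
a hypothesis; with its proof `seqPointedConv_holds` (`ProfilePointedSeqConvProof.lean`) it is THE THEOREM, CONDITIONAL
on the named fact `BiIndepDensityLogConcave` (Theorem A, Brändén–Huh) and on nothing else: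

* `pointedRowAt_disjointSum_of_fact` — **(Ĉ) IS CLOSED UNDER DIRECT SUMS**: for `p ∈ E₁`, (Ĉ) at every level of
  `(M₁, p)` gives (Ĉ) at every level of `(M₁ ⊕ M₂, p)` (Mathlib's `Matroid.disjointSum`);
* `not_pointedRowAt_disjointSum_of_fact` — **MINIMAL (Ĉ)-WITNESSES ARE CONNECTED**: a (Ĉ)-failure at `(M₁ ⊕ M₂, p)`
  is already a failure at `(M₁, p)` (the coloop theorem of `ProfilePointedColoopExtension.lean` is the case
  `M₂ = U_{1,1}`).

Nothing here asserts (Ĉ).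
-/

open scoped Matroid

namespace PercRepro.Cogirth

open Finset ThmH Skew

variable {α : Type} [DecidableEq α]

/-! ### Finite sums: `range (k + 1)` as `Icc 0 k` in `ℤ`, and the convolution translated -/

/-- A sum over `range (k + 1)` is a sum over `Icc (0 : ℤ) k`. -/
theorem sum_range_eq_sum_Icc_int (k : ℕ) (F : ℤ → ℚ) :
    ∑ j ∈ range (k + 1), F j = ∑ j ∈ Icc (0 : ℤ) k, F j := by
  apply Finset.sum_nbij' (fun j : ℕ => (j : ℤ)) (fun j : ℤ => j.toNat)
  · intro j hj
    simp only [mem_range] at hj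
    simp only [mem_Icc]
    omega
  · intro j hj
    simp only [mem_Icc] at hj
    simp only [mem_range]
    have := Int.toNat_of_nonneg hj.1
    omega
  · intro j _
    simp
  · intro j hj
    simp only [mem_Icc] at hj
    exact Int.toNat_of_nonneg hj.1
  · intro j _
    rfl

/-- **The convolution, translated**: for `f, g : ℕ → ℕ` with zero-extensions `F, G : ℤ → ℚ` (`G` vanishing above
`N₂`), `Σ_{j ≤ k} f j · g (k − j) = Σ_{j ∈ Icc 0 N₂} G j · F (k − j)` in `ℚ`. -/
theorem conv_cast (F G : ℤ → ℚ) (f g : ℕ → ℕ) (hF : ∀ j : ℕ, F j = f j) (hG : ∀ j : ℕ, G j = g j)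
    (hF0 : ∀ i : ℤ, i < 0 → F i = 0) (hG0 : ∀ i : ℤ, i < 0 → G i = 0) (N₂ : ℕ)
    (hGN : ∀ i : ℤ, (N₂ : ℤ) < i → G i = 0) (k : ℕ) :
    ((∑ j ∈ range (k + 1), f j * g (k - j) : ℕ) : ℚ) = ∑ j ∈ Icc (0 : ℤ) N₂, G j * F ((k : ℤ) - j) := by
  have h1 : ((∑ j ∈ range (k + 1), f j * g (k - j) : ℕ) : ℚ) =
      ∑ j ∈ range (k + 1), F j * G ((k : ℤ) - j) := by
    push_cast
    apply Finset.sum_congr rfl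
    intro j hj
    have hjk : j ≤ k := by have := mem_range.1 hj; omega
    rw [hF j, ← Nat.cast_sub hjk, hG (k - j)]
  rw [h1, sum_range_eq_sum_Icc_int k (fun j => F j * G ((k : ℤ) - j)),
    sum_Icc_reflect 0 k k (by ring) (fun j => F j * G ((k : ℤ) - j))]
  have h2 : ∑ j ∈ Icc (0 : ℤ) k, F ((k : ℤ) - j) * G ((k : ℤ) - ((k : ℤ) - j)) =
      ∑ j ∈ Icc (0 : ℤ) k, G j * F ((k : ℤ) - j) := by
    apply Finset.sum_congr rfl
    intro j _
    rw [show (k : ℤ) - ((k : ℤ) - j) = j by ring]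
    ring
  rw [h2]
  apply sum_eq_sum_of_support
  · intro j hj
    simp only [mem_Icc, not_and_or, not_le] at hj
    rcases hj with hj | hj
    · rw [hG0 j hj]; ring
    · rw [hF0 ((k : ℤ) - j) (by omega)]; ring
  · intro j hj
    simp only [mem_Icc, not_and_or, not_le] at hj
    rcases hj with hj | hj
    · rw [hG0 j hj]; ring
    · rw [hGN j hj]; ring

/-! ### The profile and the extension counts as zero-extended sequences `ℤ → ℚ` -/

/-- The bi-independent profile of `N` as a zero-extended sequence `ℤ → ℚ`. -/
noncomputable def profZ (N : Matroid α) [N.Finite] (i : ℤ) : ℚ :=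
  if 0 ≤ i then ((biIndepSets N i.toNat).card : ℚ) else 0

/-- The extension counts `c^p` of `(N, p)` as a zero-extended sequence `ℤ → ℚ`. -/
noncomputable def extZ (N : Matroid α) [N.Finite] (p : α) (i : ℤ) : ℚ :=
  if 0 ≤ i then (extCount N i.toNat p : ℚ) else 0

variable {N : Matroid α} [N.Finite]

/-- `profZ` at a natural number is the profile. -/
theorem profZ_natCast (j : ℕ) : profZ N (j : ℤ) = (biIndepSets N j).card := by
  unfold profZ
  rw [if_pos (Int.natCast_nonneg j), Int.toNat_natCast]

/-- `extZ` at a natural number is the extension count. -/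
theorem extZ_natCast {p : α} (j : ℕ) : extZ N p (j : ℤ) = extCount N j p := by
  unfold extZ
  rw [if_pos (Int.natCast_nonneg j), Int.toNat_natCast]

/-- `profZ` vanishes below `0`. -/
theorem profZ_of_neg {i : ℤ} (hi : i < 0) : profZ N i = 0 := by
  unfold profZ
  rw [if_neg (not_le.2 hi)]

/-- `extZ` vanishes below `0`. -/
theorem extZ_of_neg {p : α} {i : ℤ} (hi : i < 0) : extZ N p i = 0 := by
  unfold extZ
  rw [if_neg (not_le.2 hi)]

/-- No bi-independent `k`-set above the size of the ground set. -/
theorem card_biIndepSets_eq_zero_of_lt {k : ℕ} (hk : (gr N).card < k) : (biIndepSets N k).card = 0 := by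
  rw [card_eq_zero, Finset.eq_empty_iff_forall_notMem]
  intro X hX
  rw [mem_biIndepSets] at hX
  have := card_le_card hX.1
  omega

/-- No extension count above the size of the ground set. -/
theorem extCount_eq_zero_of_lt {p : α} {k : ℕ} (hk : (gr N).card < k) : extCount N k p = 0 := by
  have h1 : extCount N k p ≤ (biIndepSets N k).card := card_filter_le _ _
  rw [card_biIndepSets_eq_zero_of_lt hk] at h1
  omega

/-- `profZ` vanishes above `#E`. -/
theorem profZ_of_gt {i : ℤ} (hi : ((gr N).card : ℤ) < i) : profZ N i = 0 := by
  unfold profZ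
  have h0 : 0 ≤ i := by omega
  have := Int.toNat_of_nonneg h0
  rw [if_pos h0, card_biIndepSets_eq_zero_of_lt (by omega)]
  simp

/-- `extZ` vanishes above `#E − 1` (`extCount_top` at `#E`, emptiness beyond). -/
theorem extZ_of_gt {p : α} (hp : p ∈ gr N) {i : ℤ} (hi : ((gr N).card : ℤ) - 1 < i) : extZ N p i = 0 := by
  unfold extZ
  have h0 : 0 ≤ i := by omega
  have := Int.toNat_of_nonneg h0
  rw [if_pos h0]
  rcases eq_or_lt_of_le (show (gr N).card ≤ i.toNat by omega) with h | h
  · rw [← h, extCount_top hp]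
    simp
  · rw [extCount_eq_zero_of_lt h]
    simp

/-- `profZ ≥ 0`. -/
theorem profZ_nonneg (i : ℤ) : 0 ≤ profZ N i := by
  unfold profZ
  split_ifs <;> positivity

/-- `extZ ≥ 0`. -/
theorem extZ_nonneg {p : α} (i : ℤ) : 0 ≤ extZ N p i := by
  unfold extZ
  split_ifs <;> positivity

/-- The symmetry `P_{N−i} = P_i` on `ℤ`. -/
theorem profZ_symm (i : ℤ) : profZ N (((gr N).card : ℤ) - i) = profZ N i := by
  rcases lt_or_ge i 0 with hi | hi
  · rw [profZ_of_neg hi, profZ_of_gt (by omega)]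
  rcases le_or_gt i ((gr N).card : ℤ) with hiN | hiN
  · obtain ⟨j, rfl⟩ : ∃ j : ℕ, i = j := ⟨i.toNat, (Int.toNat_of_nonneg hi).symm⟩
    have hjN : j ≤ (gr N).card := by exact_mod_cast hiN
    rw [← Nat.cast_sub hjN, profZ_natCast, profZ_natCast]
    exact_mod_cast (card_biIndepSets_symm N hjN).symm
  · rw [profZ_of_gt hiN, profZ_of_neg (by omega)]

/-- The symmetry `c^p_{N−1−i} = c^p_i` on `ℤ`. -/
theorem extZ_symm {p : α} (hp : p ∈ gr N) (i : ℤ) : extZ N p (((gr N).card : ℤ) - 1 - i) = extZ N p i := by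
  rcases lt_or_ge i 0 with hi | hi
  · rw [extZ_of_neg hi, extZ_of_gt hp (by omega)]
  rcases le_or_gt i (((gr N).card : ℤ) - 1) with hiN | hiN
  · obtain ⟨j, rfl⟩ : ∃ j : ℕ, i = j := ⟨i.toNat, (Int.toNat_of_nonneg hi).symm⟩
    have hjN : j + 1 ≤ (gr N).card := by omega
    rw [show ((gr N).card : ℤ) - 1 - (j : ℤ) = (((gr N).card - 1 - j : ℕ) : ℤ) by
      rw [Nat.cast_sub (by omega), Nat.cast_sub (by omega)]; push_cast; ring, extZ_natCast, extZ_natCast]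
    exact_mod_cast (extCount_symm hp j hjN).symm
  · rw [extZ_of_gt hp hiN, extZ_of_neg (by omega)]

/-- Theorem A for the profile, on `ℤ` (from the named fact). -/
theorem profZ_thmA (hfact : BiIndepDensityLogConcave α) (i : ℤ) (hi : 0 ≤ i)
    (h2 : 2 * i + 2 ≤ ((gr N).card : ℤ)) :
    (((gr N).card : ℚ) - i) * profZ N i ≤ (i + 1) * profZ N (i + 1) := by
  obtain ⟨j, rfl⟩ : ∃ j : ℕ, i = j := ⟨i.toNat, (Int.toNat_of_nonneg hi).symm⟩
  have hj : 2 * j + 2 ≤ (gr N).card := by exact_mod_cast h2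
  have h := biIndepDensity_mono_of_fact hfact N j hj
  rw [← Nat.cast_succ, profZ_natCast, profZ_natCast]
  have h' : (((gr N).card - j : ℕ) : ℚ) * ((biIndepSets N j).card : ℚ) ≤
      ((j + 1 : ℕ) : ℚ) * ((biIndepSets N (j + 1)).card : ℚ) := by exact_mod_cast h
  rw [Nat.cast_sub (by omega)] at h'
  push_cast at h' ⊢
  exact h'

/-- `extZ ≡ 0` at a loop `p`. -/
theorem extZ_of_not_indep {p : α} (hp : ¬ N.Indep {p}) (i : ℤ) : extZ N p i = 0 := by
  unfold extZ
  split_ifs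
  · rw [extCount_eq_zero_of_not_indep hp]
    simp
  · rfl

/-- Theorem A for the extension counts `c^p = P(N / p)` on `#E − 1` elements, on `ℤ` (from the named fact for the
contraction; trivial at a loop `p`). -/
theorem extZ_thmA (hfact : BiIndepDensityLogConcave α) {p : α} (hp : p ∈ gr N) (i : ℤ) (hi : 0 ≤ i)
    (h2 : 2 * i + 2 ≤ ((gr N).card : ℤ) - 1) :
    (((gr N).card : ℚ) - 1 - i) * extZ N p i ≤ (i + 1) * extZ N p (i + 1) := by
  by_cases hp1 : N.Indep {p}
  · obtain ⟨j, rfl⟩ : ∃ j : ℕ, i = j := ⟨i.toNat, (Int.toNat_of_nonneg hi).symm⟩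
    have hN : (gr (N ／ ({p} : Set α))).card = (gr N).card - 1 := by
      rw [gr_contract', card_erase_of_mem hp]
    have hj : 2 * j + 2 ≤ (gr (N ／ ({p} : Set α))).card := by rw [hN]; omega
    have h := biIndepDensity_mono_of_fact hfact (N ／ ({p} : Set α)) j hj
    rw [hN] at h
    rw [← Nat.cast_succ, extZ_natCast, extZ_natCast, extCount_eq_card_biIndepSets_contract hp1,
      extCount_eq_card_biIndepSets_contract hp1]
    have h' : (((gr N).card - 1 - j : ℕ) : ℚ) * ((biIndepSets (N ／ ({p} : Set α)) j).card : ℚ) ≤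
        ((j + 1 : ℕ) : ℚ) * ((biIndepSets (N ／ ({p} : Set α)) (j + 1)).card : ℚ) := by exact_mod_cast h
    rw [Nat.cast_sub (by omega), Nat.cast_sub (by omega)] at h'
    push_cast at h' ⊢
    exact h'
  · rw [extZ_of_not_indep hp1, extZ_of_not_indep hp1]
    simp

/-- `c^p_0 = P_0` on `ℤ`. -/
theorem extZ_zero {p : α} (hp : p ∈ gr N) : extZ N p 0 = profZ N 0 := by
  rw [show (0 : ℤ) = ((0 : ℕ) : ℤ) from rfl, extZ_natCast, profZ_natCast, extCount_zero hp]

/-- The (Ĉ)-instances of `PointedRowAt N p`, on `ℤ`. -/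
theorem pointedRowAt_Z {p : α} (h : PointedRowAt N p) (i : ℤ) (hi : 0 ≤ i)
    (h2 : 2 * i + 2 ≤ ((gr N).card : ℤ)) :
    (((gr N).card : ℚ) - i - 1) * profZ N i ≤
      i * profZ N (i + 1) + (((gr N).card : ℚ) - 2 * i - 1) * extZ N p i := by
  obtain ⟨j, rfl⟩ : ∃ j : ℕ, i = j := ⟨i.toNat, (Int.toNat_of_nonneg hi).symm⟩
  have hj : 2 * j + 2 ≤ (gr N).card := by exact_mod_cast h2
  have hh := h j hj
  rw [← Nat.cast_succ, profZ_natCast, profZ_natCast, extZ_natCast]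
  obtain ⟨m, hm⟩ := Nat.exists_eq_add_of_le hj
  rw [hm, show 2 * j + 2 + m - j - 1 = j + 1 + m by omega,
    show 2 * j + 2 + m - 2 * j - 1 = m + 1 by omega] at hh
  have hm' : ((gr N).card : ℚ) = 2 * j + 2 + m := by exact_mod_cast hm
  have hh' : ((j + 1 + m : ℕ) : ℚ) * ((biIndepSets N j).card : ℚ) ≤
      (j : ℚ) * ((biIndepSets N (j + 1)).card : ℚ) + ((m + 1 : ℕ) : ℚ) * (extCount N j p : ℚ) := by
    exact_mod_cast hh
  rw [hm']
  push_cast at hh' ⊢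
  linarith

/-! ### The convolutions of the direct sum, on `ℤ` -/

variable {M₁ M₂ : Matroid α} [M₁.Finite] [M₂.Finite]

/-- `P_k(M₁ ⊕ M₂) = Σ_{j ∈ Icc 0 N₂} a_j · P_{k−j}` on `ℤ`. -/
theorem profZ_disjointSum (h : Disjoint M₁.E M₂.E) [(M₁.disjointSum M₂ h).Finite] (k : ℕ) :
    profZ (M₁.disjointSum M₂ h) k =
      ∑ j ∈ Icc (0 : ℤ) (gr M₂).card, profZ M₂ j * profZ M₁ ((k : ℤ) - j) := by
  rw [profZ_natCast, card_biIndepSets_disjointSum h k]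
  exact conv_cast (profZ M₁) (profZ M₂) (fun j => (biIndepSets M₁ j).card) (fun j => (biIndepSets M₂ j).card)
    (fun j => profZ_natCast j) (fun j => profZ_natCast j) (fun i hi => profZ_of_neg hi)
    (fun i hi => profZ_of_neg hi) (gr M₂).card (fun i hi => profZ_of_gt hi) k

/-- `c^p_k(M₁ ⊕ M₂) = Σ_{j ∈ Icc 0 N₂} a_j · c^p_{k−j}` on `ℤ`, for `p ∈ E₁`. -/
theorem extZ_disjointSum (h : Disjoint M₁.E M₂.E) [(M₁.disjointSum M₂ h).Finite] {p : α} (hp : p ∈ gr M₁)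
    (k : ℕ) :
    extZ (M₁.disjointSum M₂ h) p k =
      ∑ j ∈ Icc (0 : ℤ) (gr M₂).card, profZ M₂ j * extZ M₁ p ((k : ℤ) - j) := by
  rw [extZ_natCast, extCount_disjointSum h hp k]
  exact conv_cast (extZ M₁ p) (profZ M₂) (fun j => extCount M₁ j p) (fun j => (biIndepSets M₂ j).card)
    (fun j => extZ_natCast j) (fun j => profZ_natCast j) (fun i hi => extZ_of_neg hi)
    (fun i hi => profZ_of_neg hi) (gr M₂).card (fun i hi => profZ_of_gt hi) k

/-! ### The bridge -/

/-- **(Ĉ) IS CLOSED UNDER DIRECT SUMS, MODULO THE SEQUENCE-LEVEL THEOREM** (and CONDITIONAL on the named fact):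
if `SeqPointedConv` holds, then for `p ∈ E₁`, (Ĉ) at every level of `(M₁, p)` gives (Ĉ) at every level of
`(M₁ ⊕ M₂, p)`. -/
theorem pointedRowAt_disjointSum_of_seq (hseq : SeqPointedConv) (hfact : BiIndepDensityLogConcave α)
    (h : Disjoint M₁.E M₂.E) [(M₁.disjointSum M₂ h).Finite] {p : α} (hp : p ∈ gr M₁)
    (h₁ : PointedRowAt M₁ p) : PointedRowAt (M₁.disjointSum M₂ h) p := by
  intro k hk
  have hN : (gr (M₁.disjointSum M₂ h)).card = (gr M₁).card + (gr M₂).card := by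
    rw [gr_disjointSum h, card_union_of_disjoint (disjoint_gr_gr h)]
  have key := hseq (gr M₁).card (gr M₂).card (profZ M₁) (extZ M₁ p) (profZ M₂)
    (fun i hi => profZ_of_neg hi) (fun i hi => profZ_of_gt hi) profZ_symm profZ_nonneg (profZ_thmA hfact)
    (fun i hi => extZ_of_neg hi) (fun i hi => extZ_of_gt hp hi) (extZ_symm hp) extZ_nonneg
    (extZ_thmA hfact hp) (extZ_zero hp) (pointedRowAt_Z h₁)
    (fun j hj => profZ_of_neg hj) (fun j hj => profZ_of_gt hj) profZ_symm profZ_nonneg (profZ_thmA hfact)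
    k (by positivity) (by rw [hN] at hk; exact_mod_cast hk)
  have e1 := profZ_disjointSum h k
  have e2 := profZ_disjointSum h (k + 1)
  have e3 := extZ_disjointSum h hp k
  push_cast at e2
  rw [← e1, ← e2, ← e3, profZ_natCast, ← Nat.cast_succ, profZ_natCast, extZ_natCast] at key
  obtain ⟨m, hm⟩ := Nat.exists_eq_add_of_le hk
  rw [hm, show 2 * k + 2 + m - k - 1 = k + 1 + m by omega, show 2 * k + 2 + m - 2 * k - 1 = m + 1 by omega]
  have hNq : ((gr M₁).card : ℚ) + (gr M₂).card = 2 * k + 2 + m := by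
    have h' : (gr M₁).card + (gr M₂).card = 2 * k + 2 + m := by rw [← hN]; exact hm
    exact_mod_cast h'
  rw [Nat.succ_eq_add_one] at key
  have key' : ((k + 1 + m : ℕ) : ℚ) * ((biIndepSets (M₁.disjointSum M₂ h) k).card : ℚ) ≤
      (k : ℚ) * ((biIndepSets (M₁.disjointSum M₂ h) (k + 1)).card : ℚ) +
        ((m + 1 : ℕ) : ℚ) * (extCount (M₁.disjointSum M₂ h) k p : ℚ) := by
    push_cast at key ⊢
    rw [hNq] at key
    linarith
  exact_mod_cast key'

/-- **MINIMAL (Ĉ)-WITNESSES ARE CONNECTED, MODULO THE SEQUENCE-LEVEL THEOREM** (and the named fact): a failure of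
(Ĉ) at `(M₁ ⊕ M₂, p)` with `p ∈ E₁` is already a failure at `(M₁, p)`. -/
theorem not_pointedRowAt_disjointSum_of_seq (hseq : SeqPointedConv) (hfact : BiIndepDensityLogConcave α)
    (h : Disjoint M₁.E M₂.E) [(M₁.disjointSum M₂ h).Finite] {p : α} (hp : p ∈ gr M₁)
    (hS : ¬ PointedRowAt (M₁.disjointSum M₂ h) p) : ¬ PointedRowAt M₁ p :=
  fun h₁ => hS (pointedRowAt_disjointSum_of_seq hseq hfact h hp h₁)

/-! ### The theorem (with `seqPointedConv_holds`) -/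

/-- **(Ĉ) IS CLOSED UNDER DIRECT SUMS** (CONDITIONAL on the named fact): for `p ∈ E₁`, (Ĉ) at every level of
`(M₁, p)` gives (Ĉ) at every level of `(M₁ ⊕ M₂, p)`. -/
theorem pointedRowAt_disjointSum_of_fact (hfact : BiIndepDensityLogConcave α) (h : Disjoint M₁.E M₂.E)
    [(M₁.disjointSum M₂ h).Finite] {p : α} (hp : p ∈ gr M₁) (h₁ : PointedRowAt M₁ p) :
    PointedRowAt (M₁.disjointSum M₂ h) p :=
  pointedRowAt_disjointSum_of_seq seqPointedConv_holds hfact h hp h₁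

/-- **MINIMAL (Ĉ)-WITNESSES ARE CONNECTED** (CONDITIONAL on the named fact): a failure of (Ĉ) at `(M₁ ⊕ M₂, p)`
with `p ∈ E₁` is already a failure at `(M₁, p)` — on fewer elements whenever `M₂` is non-empty. -/
theorem not_pointedRowAt_disjointSum_of_fact (hfact : BiIndepDensityLogConcave α) (h : Disjoint M₁.E M₂.E)
    [(M₁.disjointSum M₂ h).Finite] {p : α} (hp : p ∈ gr M₁)
    (hS : ¬ PointedRowAt (M₁.disjointSum M₂ h) p) : ¬ PointedRowAt M₁ p :=
  fun h₁ => hS (pointedRowAt_disjointSum_of_fact hfact h hp h₁)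

end PercRepro.Cogirth
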